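import Summits.NavierStokesRegularity.NavierStokesRegularity.Theses.TypeICertificateLadder
import Summits.NavierStokesRegularity.NavierStokesRegularity.Theorems.TypeICertificateLadderNoBlowupToClayLemmas
import Literature.Analysis.FluidPDE.BarkerPrangeConcentrationHolds
import Literature.Analysis.FluidPDE.BarkerPrangeConcentrationProofs
import Literature.Analysis.FluidPDE.NSCriticalClosureBesovKatoClass
import Literature.Analysis.FluidPDE.NSCriticalClosureBesovBounded
import Literature.Analysis.FluidPDE.NSLerayExistenceR3Holds
import Literature.Analysis.FluidPDE.NSWeakStrongUniquenessHolds
import Literature.Analysis.FluidPDE.NSLerayHopfSereginProofs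
import Literature.Analysis.FluidPDE.LerayLocalRegularH1Proofs
import Literature.Analysis.FluidPDE.CKN1982Setting

/-!
# Route TypeICertificateLadder — lemmas for `CertificateSoundness` (item stmt-NavierStokesRegularity-2883)

Solution-dependent `L³` concentration at the similarity scale for a classical Leray–Hopf
solution from a rapidly decaying datum which blows up at `T` at the Type I rate:

* `exists_isGlobalLerayHopf_graft` — a classical solution on `[0, T)`, Leray–Hopf on `[0, T]`
  from its rapidly decaying datum, agrees below `T` with a GLOBAL Leray–Hopf weak solution from
  the same datum (Leray's weak solution grafted at `T`; Prodi–Serrin weak–strong uniqueness below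
  `T`, where the classical solution is bounded on closed sub-strips);
* `exists_L3_concentration_of_morrey` — if moreover `u` satisfies a Morrey-type bound
  `∫_{B(x₁, ρ)} |u(t)|² ≤ M₀ ρ` near `T` (the Type I condition (e.typeI) of Barker–Prange) and does
  not extend smoothly past `T`, then at the singular point `(T, x₀)` of Lemarié-Rieusset's
  Thm. 15.1 (C) the `L³` norm on the balls `B(x₀, ρ √(ν (T − t)))` stays `> γ ν` for all `t`
  near `T` — Barker–Prange 2020, Thm. 2 (`BarkerPrange2020_thm2_holds`), with constants depending
  on the solution through `M₀`.

## References

* T. Barker, C. Prange, ARMA 236 (2020), Thm. 2 (arXiv:1812.09115, pp. 4–5).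
* P. G. Lemarié-Rieusset, *The Navier–Stokes Problem in the 21st Century*, CRC 2016,
  Thm. 15.1 (C).
* J. C. Robinson, J. L. Rodrigo, W. Sadowski, *The Three-Dimensional Navier–Stokes Equations*,
  CUP 2016, Thm. 8.19.
-/

noncomputable section

open Literature.Analysis.FluidPDE MeasureTheory Set Function Filter Topology Metric
open scoped ENNReal NNReal

namespace Summit.NavierStokesRegularity.NavierStokesRegularity.Theorems

namespace CertificateSoundness

variable {ν T : ℝ} {u : ℝ → EuclideanSpace ℝ (Fin 3) → EuclideanSpace ℝ (Fin 3)}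
  {p : ℝ → EuclideanSpace ℝ (Fin 3) → ℝ}

/-! ### A global Leray–Hopf solution through a classical one -/

/-- **Grafting Leray's weak solution at the blow-up time.** A classical solution `u` of the
unforced Navier–Stokes system on `ℝ³ × [0, T)`, Leray–Hopf on `[0, T]` from its rapidly decaying
datum `u 0`, agrees at every time `t < T` with a global Leray–Hopf weak solution `v` from `u 0`:
take Leray's global weak solution (`leray_existence_R3_holds`), note that it coincides with `u`
a.e. on every slice `0 < t < T` by weak–strong uniqueness (`weak_strong_uniqueness_holds`; `u` is
bounded on closed sub-strips, `exists_forall_norm_le_of_tao2011`), reset its free slice at `t = 0`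
(`isLerayHopfOn_update_initial`) and replace its slices below `T` by those of `u`
(`IsLerayHopfOn.congr_ae_slices`).
[cite: RobinsonRodrigoSadowski2016, Thm. 8.19; Leray1934, §31] -/
theorem exists_isGlobalLerayHopf_graft (hν : 0 < ν) (hT : 0 < T)
    (hsol : IsClassicalNSSolutionOn (Ico 0 T) ν 0 u p) (hLH : IsLerayHopfOn T ν 0 (u 0) u)
    (h₀ : HasRapidSpatialDecay (u 0)) :
    ∃ v : ℝ → EuclideanSpace ℝ (Fin 3) → EuclideanSpace ℝ (Fin 3),
      IsGlobalLerayHopf ν 0 (u 0) v ∧ ∀ t < T, v t = u t := by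
  classical
  have hu2 : MemLp (u 0) 2 volume := hLH.memLp 0 ⟨le_rfl, hT.le⟩
  have hwdiv : IsWeaklyDivFree (u 0) := hLH.isWeaklyDivFree_datum hT
  obtain ⟨v, hv⟩ := leray_existence_R3_holds ν hν (u 0) hu2 hwdiv
  -- `v(t) = u(t)` a.e. for `0 < t < T` (Prodi–Serrin on `[0, (t + T)/2]`, where `u` is bounded)
  have hvu : ∀ t ∈ Ioo 0 T, v t =ᵐ[volume] u t := by
    intro t ht
    have hT₁ : (t + T) / 2 ∈ Ioo 0 T := ⟨by linarith [ht.1], by linarith [ht.2]⟩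
    obtain ⟨M, hM⟩ :=
      exists_forall_norm_le_of_tao2011 tao2011_hasBoundedSobolevNormsOn_holds hν hsol hLH h₀ _ hT₁
    have hmeas : ∀ s ∈ Icc 0 ((t + T) / 2), AEStronglyMeasurable (u s) volume := fun s hs =>
      (hsol.contDiff_velocity ⟨hs.1, hs.2.trans_lt hT₁.2⟩).continuous.aestronglyMeasurable
    have hSer : MemLqLp ∞ ∞ u (Ioo 0 ((t + T) / 2)) := memLqLp_top_top_of_bound hmeas hM
    exact weak_strong_uniqueness_holds hν hT₁.1 (hLH.of_le hT₁.2.le) (q := ⊤) (r := ⊤)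
      ENNReal.ofNat_lt_top (by simp [ENNReal.div_top]) hSer (hv.isLerayHopfOn hT₁.1) t
      ⟨ht.1, by linarith [ht.2]⟩
  -- the graft
  set w : ℝ → EuclideanSpace ℝ (Fin 3) → EuclideanSpace ℝ (Fin 3) :=
    fun t => if t < T then u t else v t with hw_def
  have hwlt : ∀ {t : ℝ}, t < T → w t = u t := fun {t} ht => by simp only [hw_def, if_pos ht]
  have hwge : ∀ {t : ℝ}, ¬ t < T → w t = v t := fun {t} ht => by simp only [hw_def, if_neg ht]
  refine ⟨w, fun T' hT' => ?_, fun t ht => hwlt ht⟩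
  have hv' : IsLerayHopfOn T' ν 0 (u 0) (fun t => if t = 0 then u 0 else v t) :=
    isLerayHopfOn_update_initial (hv.isLerayHopfOn hT') hu2
  refine hv'.congr_ae_slices hT' ?_ ?_
  · -- joint measurability of the graft on `(0, T') × ℝ³`
    have hpw : uncurry w =
        (Iio T ×ˢ (univ : Set (EuclideanSpace ℝ (Fin 3)))).piecewise (uncurry u) (uncurry v) := by
      funext z
      obtain ⟨t, x⟩ := z
      by_cases ht : t < T
      · rw [piecewise_eq_of_mem _ _ _ (show (t, x) ∈ Iio T ×ˢ univ from ⟨ht, mem_univ _⟩)]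
        simp only [uncurry_apply_pair, hwlt ht]
      · rw [piecewise_eq_of_notMem _ _ _
          (show (t, x) ∉ Iio T ×ˢ (univ : Set (EuclideanSpace ℝ (Fin 3))) from
            fun h => ht h.1)]
        simp only [uncurry_apply_pair, hwge ht]
    rw [hpw]
    have hS : MeasurableSet (Iio T ×ˢ (univ : Set (EuclideanSpace ℝ (Fin 3)))) :=
      measurableSet_Iio.prod MeasurableSet.univ
    refine AEStronglyMeasurable.piecewise hS ?_ ?_
    · rw [Measure.restrict_restrict hS]
      have hsub : Iio T ×ˢ (univ : Set (EuclideanSpace ℝ (Fin 3))) ∩ Ioo 0 T' ×ˢ univ ⊆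
          Ico 0 T ×ˢ univ := by
        rintro ⟨t, x⟩ ⟨h1, h2⟩
        exact ⟨⟨h2.1.1.le, h1.1⟩, mem_univ _⟩
      have hcont : ContinuousOn (uncurry u) (Ico 0 T ×ˢ univ) := hsol.smooth_velocity.continuousOn
      exact (hcont.mono hsub).aestronglyMeasurable
        (hS.inter (measurableSet_Ioo.prod MeasurableSet.univ))
    · exact (hv T' hT').weak.1.mono_measure Measure.restrict_le_self
  · -- slices
    intro t ht
    rcases eq_or_lt_of_le ht.1 with h0 | hpos
    · subst h0
      rw [hwlt hT]
      simp
    · have hne : ¬ t = 0 := hpos.ne'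
      simp only [if_neg hne]
      by_cases htT : t < T
      · rw [hwlt htT]
        exact (hvu t ⟨hpos, htT⟩).symm
      · rw [hwge htT]

/-! ### `L³` concentration at the similarity scale (Barker–Prange, Thm. 2) -/

/-- **`L³` concentration near a Type I singularity, solution-dependent constants**
(Barker–Prange 2020, Thm. 2, applied to the global Leray–Hopf graft of
`exists_isGlobalLerayHopf_graft`). Let `(u, p)` be classical on `ℝ³ × [0, T)`, Leray–Hopf on
`[0, T]` from its rapidly decaying datum, NOT smoothly extendable past `T`, and suppose the
Morrey-type bound `∫_{B(x₁, ρ)} |u(t)|² ≤ M₀ ρ` for all `T₁ < t < T`, all centres and all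
`0 < ρ ≤ r₀`. Then there are `x₀`, `ρ > 0`, `γ > 0` and `t₁ < T` with
`γ ν < ‖u(t)‖_{L³(B(x₀, ρ √(ν (T − t))))}` for all `t₁ < t < T`: the singular point `(T, x₀)` is
supplied by Lemarié-Rieusset 2016, Thm. 15.1 (C)
(`exists_singularPoint_of_classical_of_not_hasSmoothExtensionPast`), points of the open strip are
regular because `u` is bounded on closed sub-strips, and `BarkerPrange2020_thm2_holds` gives the
concentration on `|x − x₀| ≤ 2√(ν(T − t)/S)`, a subset of the open ball of radius
`(2/√S + 1) √(ν (T − t))`.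
[cite: BarkerPrange2020, Thm. 2 (arXiv:1812.09115, pp. 4–5); LemarieRieusset2016, Thm. 15.1 (C)] -/
theorem exists_L3_concentration_of_morrey (hν : 0 < ν) (hT : 0 < T)
    (hsol : IsClassicalNSSolutionOn (Ico 0 T) ν 0 u p) (hLH : IsLerayHopfOn T ν 0 (u 0) u)
    (h₀ : HasRapidSpatialDecay (u 0)) (hext : ¬ HasSmoothExtensionPast ν 0 u T)
    {r₀ M₀ T₁ : ℝ} (hr₀ : 0 < r₀) (hT₁ : T₁ < T)
    (hMor : ∀ t ∈ Ioo T₁ T, ∀ (x₁ : EuclideanSpace ℝ (Fin 3)) (ρ : ℝ), 0 < ρ → ρ ≤ r₀ →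
      ∫ x in ball x₁ ρ, ‖u t x‖ ^ 2 ≤ M₀ * ρ) :
    ∃ (x₀ : EuclideanSpace ℝ (Fin 3)) (ρ γ t₁ : ℝ), 0 < ρ ∧ 0 < γ ∧ t₁ < T ∧
      ∀ t ∈ Ioo t₁ T, ENNReal.ofReal (γ * ν) <
        eLpNorm (u t) 3 (volume.restrict (ball x₀ (ρ * Real.sqrt (ν * (T - t))))) := by
  obtain ⟨γ, hγ, hBP⟩ := BarkerPrange2020_thm2_holds
  -- the Morrey constant in Barker–Prange's normalisation
  set M : ℝ := Real.sqrt (max M₀ 1) / ν with hM_def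
  have hMpos : 0 < M := by positivity
  obtain ⟨S, hS, -, hBP'⟩ := hBP M hMpos
  -- radii below `r₁` only see times in `(T₁, T)`
  set T₁' : ℝ := max T₁ 0 with hT₁'_def
  have hT₁'T : T₁' < T := max_lt hT₁ hT
  set r₁ : ℝ := min r₀ (Real.sqrt (ν * (T - T₁'))) with hr₁_def
  have hr₁ : 0 < r₁ := lt_min hr₀ (Real.sqrt_pos.2 (mul_pos hν (sub_pos.2 hT₁'T)))
  obtain ⟨tStar, -, htStarT, -, hBP''⟩ :=
    hBP' ν T hν hT (ENNReal.ofReal r₁) (ENNReal.ofReal_pos.2 hr₁)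
  -- the global Leray–Hopf graft
  obtain ⟨v, hv, hvu⟩ := exists_isGlobalLerayHopf_graft hν hT hsol hLH h₀
  -- (i) the Morrey bound in `L²` form
  have hMorv : ∀ (y : EuclideanSpace ℝ (Fin 3)) (r : ℝ), 0 < r → ENNReal.ofReal r < ENNReal.ofReal r₁ →
      ∀ t : ℝ, 0 < t → T - r ^ 2 / ν < t → t < T →
        eLpNorm (v t) 2 (volume.restrict (ball y r)) ≤ ENNReal.ofReal (M * ν * Real.sqrt r) := by
    intro y r hr hrr₁ t ht0 htr htT
    have hr' : r < r₁ := (ENNReal.ofReal_lt_ofReal_iff hr₁).1 hrr₁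
    have hrr₀ : r ≤ r₀ := hr'.le.trans (min_le_left _ _)
    have hT₁t : T₁ < t := by
      have h1 : r < Real.sqrt (ν * (T - T₁')) := hr'.trans_le (min_le_right _ _)
      have h2 : r ^ 2 < ν * (T - T₁') := by
        calc r ^ 2 < Real.sqrt (ν * (T - T₁')) ^ 2 := by gcongr
          _ = ν * (T - T₁') := Real.sq_sqrt (by positivity)
      have h3 : r ^ 2 / ν < T - T₁' := by rw [div_lt_iff₀ hν]; linarith
      linarith [le_max_left T₁ 0]
    rw [hvu t htT]
    have hint := hMor t ⟨hT₁t, htT⟩ y r hr hrr₀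
    have hmem : MemLp (u t) 2 (volume.restrict (ball y r)) :=
      (hLH.memLp t ⟨ht0.le, htT.le⟩).restrict _
    rw [hmem.eLpNorm_eq_integral_rpow_norm two_ne_zero ENNReal.ofNat_ne_top]
    refine ENNReal.ofReal_le_ofReal ?_
    simp only [ENNReal.toReal_ofNat, Real.rpow_two]
    have hI0 : 0 ≤ ∫ x in ball y r, ‖u t x‖ ^ 2 := integral_nonneg fun _ => by positivity
    rw [show ((2 : ℝ)⁻¹) = 1 / 2 by norm_num, ← Real.sqrt_eq_rpow]
    calc Real.sqrt (∫ x in ball y r, ‖u t x‖ ^ 2) ≤ Real.sqrt (max M₀ 1 * r) :=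
          Real.sqrt_le_sqrt (hint.trans (by gcongr; exact le_max_left _ _))
      _ = M * ν * Real.sqrt r := by
          rw [Real.sqrt_mul (by positivity), hM_def]
          field_simp
  -- (ii) every point of the open strip is regular
  have hreg : ∀ t ∈ Ioo 0 T, ∀ x : EuclideanSpace ℝ (Fin 3), IsRegularPoint v (t, x) := by
    intro t ht x
    have hT₂ : (t + T) / 2 ∈ Ioo 0 T := ⟨by linarith [ht.1], by linarith [ht.2]⟩
    obtain ⟨K, hK⟩ :=
      exists_forall_norm_le_of_tao2011 tao2011_hasBoundedSobolevNormsOn_holds hν hsol hLH h₀ _ hT₂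
    set ρ : ℝ := min (Real.sqrt t) (Real.sqrt ((t + T) / 2 - t)) with hρ_def
    have hρ : 0 < ρ := lt_min (Real.sqrt_pos.2 ht.1) (Real.sqrt_pos.2 (by linarith [ht.2]))
    have hρt : ρ ^ 2 ≤ t := by
      calc ρ ^ 2 ≤ Real.sqrt t ^ 2 := by gcongr; exact min_le_left _ _
        _ = t := Real.sq_sqrt ht.1.le
    have hρT : ρ ^ 2 ≤ (t + T) / 2 - t := by
      calc ρ ^ 2 ≤ Real.sqrt ((t + T) / 2 - t) ^ 2 := by gcongr; exact min_le_right _ _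
        _ = (t + T) / 2 - t := Real.sq_sqrt (by linarith [ht.2])
    refine isRegularPoint_of_ae_bound_superset (S := Icc 0 ((t + T) / 2) ×ˢ univ) (C := K) hρ
      ?_ ?_
    · intro w hw
      rw [mem_parabolicCylinderCentered] at hw
      exact ⟨⟨by linarith [hw.1.1], by linarith [hw.1.2]⟩, mem_univ _⟩
    · filter_upwards [ae_restrict_mem (measurableSet_Icc.prod MeasurableSet.univ)] with w hw
      rw [hvu w.1 (lt_of_le_of_lt hw.1.2 hT₂.2)]
      exact hK w.1 hw.1 w.2
  -- (iii) the singular point `(T, x₀)`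
  obtain ⟨x₀, hx₀⟩ :=
    exists_singularPoint_of_classical_of_not_hasSmoothExtensionPast hν hT hsol hLH h₀ hext
  have hsing : ∀ r : ℝ, 0 < r → r ^ 2 < T →
      eLpNorm (uncurry v) ∞ (volume.restrict (parabolicCylinder r ((T : ℝ), x₀))) = ∞ := by
    intro r hr hrT
    refine (eLpNorm_congr_ae ?_).trans (hx₀ r hr hrT)
    filter_upwards [ae_restrict_mem (isOpen_parabolicCylinder r ((T : ℝ), x₀)).measurableSet]
      with z hz
    obtain ⟨s, y⟩ := z
    rw [mem_parabolicCylinder] at hz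
    simp only [uncurry_apply_pair, hvu s hz.1.2]
  -- Barker–Prange at `(T, x₀)`
  have hconc := hBP'' (u 0) v hv hMorv hreg x₀ hsing
  refine ⟨x₀, 2 / Real.sqrt S + 1, γ, tStar, by positivity, hγ, htStarT, fun t ht => ?_⟩
  have h1 := hconc t ht
  rw [hvu t ht.2] at h1
  refine lt_of_lt_of_le h1 (eLpNorm_mono_measure _ (Measure.restrict_mono ?_ le_rfl))
  refine closedBall_subset_ball ?_
  have hpos : 0 < Real.sqrt (ν * (T - t)) := Real.sqrt_pos.2 (mul_pos hν (sub_pos.2 ht.2))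
  rw [Real.sqrt_div' (ν * (T - t)) hS.le]
  have : (2 / Real.sqrt S + 1) * Real.sqrt (ν * (T - t)) =
      2 * (Real.sqrt (ν * (T - t)) / Real.sqrt S) + Real.sqrt (ν * (T - t)) := by ring
  rw [this]
  linarith

end CertificateSoundness

end Summit.NavierStokesRegularity.NavierStokesRegularity.Theorems

end
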